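import Summits.BirchSwinnertonDyer.BirchSwinnertonDyer.Theses.PadicCornerSqueeze
import Summits.BirchSwinnertonDyer.BirchSwinnertonDyer.Theses.PAdicOrderV2
import Summits.BirchSwinnertonDyer.BirchSwinnertonDyer.Theses.KatoTransfer
import Summits.BirchSwinnertonDyer.BirchSwinnertonDyer.Theorems.Consistency.Negative.ConsistencyFalseWithoutNewform
import Summits.BirchSwinnertonDyer.BirchSwinnertonDyer.Theorems.PinchPrime.Negative.ContentOfCrux
import Summits.BirchSwinnertonDyer.BirchSwinnertonDyer.Theorems.PAdicOrderComparisonR2.Negative.FalseWithoutIsNewformOf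
import Literature.NumberTheory.EllipticCurves.KatoRankBound

/-! # Crux-attack probes — `PadicCornerSqueeze.AnalyticRankLePadicOrder` (stmt-BirchSwinnertonDyer-19214)

refuter-rattack-stmt-BirchSwinnertonDyer-19214-0, 2026-08-17 (crux attack at birth, route PadicCornerSqueeze, C1).
`probe` is the one deliberate elaboration sorry; everything else is sorry-free.

C (the crux): `∀ W [IsElliptic] [IsGloballyMinimal] p [Fact p.Prime], p ≠ 2 → IsOrdinaryAt W p →
  ∀ {N} [NeZero N] (f : CuspForm (Gamma0 N) 2), IsNewformOf W f → (W.analyticRank : ℕ∞) ≤ (padicLFunction f ↑(unitRoot W p)).order`.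

Findings recorded here:
* (1) elaborates; decl `Iff.rfl`-equal to its body.
* (2) RESTATES-SUMMIT, S → C: under BSD-rank, C is LITERALLY the registered Kato support item
  `KatoTransfer.KatoRankBound` (stmt-BirchSwinnertonDyer-0491, = `PAdicOrderV2.PAdicOrderKatoSideR2`, = the
  Literature fact `kato_mordellWeilRank_le_order_padicLFunction` by instantiation) with `mordellWeilRank`
  renamed `analyticRank` (`iff_katoRankBound_of_bsd`); hence `BSD → Kato → C` (`of_bsd_of_katoRankBound`,
  `of_bsd_of_katoFact`). Any counterexample to C refutes BSD-rank ∨ Kato Thm 18.4 as vendored.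
* (2c) C is the `≥ r_an` half of the equality crux stmt-0489 `PAdicOrderV2.PAdicOrderComparisonR2` (`of_comparisonR2`).
* (3) hypotheses `p ≠ 2 ∧ IsOrdinaryAt W p` inhabited IN LEAN at (E₁ = 32a2, p = 5); the newform clause is
  inhabited modulo the route's own support item `Modularity`; and the E₁-instance of C is TRUE (r_an(E₁) = 0).
* (4) every junk lever of the definitions points TRUE-wards for C: `f = 0` and `unitRoot = 0` give `L_p = 0`,
  order `⊤`; junk `analyticRank = 0` gives `0 ≤ _`.
* (5) what C buys in `closes`: C at the prime of C2 gives the UP chain `r_an ≤ r_MW` for `2 ≤ r_an`.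
* (6) mutation: `p ≠ 2` is not needed for truth-under-BSD (Kato all primes, `of_bsd_of_katoAll`);
  C restricted to `5 ≤ p` follows from X2 = `KatoTransfer.AnalyticRankLeSelmerCorank` + Kato's Selmer
  form (`five_le_of_X2_of_katoSelmer`) — the planner's rank ≥ 4 plan; C also covers `p = 3`, X2 does not.
Verdict: SURVIVES (see CruxAttack-r1.md). -/

set_option linter.dupNamespace false

namespace Summit.BirchSwinnertonDyer.BirchSwinnertonDyer.Cruxes.AnalyticRankLePadicOrder.CruxAttack

open Summit.BirchSwinnertonDyer.BirchSwinnertonDyer.Theses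
open Summit.BirchSwinnertonDyer.BirchSwinnertonDyer.Theses.PadicCornerSqueeze
open Summit.BirchSwinnertonDyer.BirchSwinnertonDyer.Theorems
open Literature.NumberTheory.EllipticCurves Literature.NumberTheory.EllipticCurves.ModularForms

-- (1) the decl elaborates
theorem probe : AnalyticRankLePadicOrder := by
  sorry

-- (1') the decl IS its body (defeq check; read back symbol by symbol in NOTES.md)
example : AnalyticRankLePadicOrder ↔
    ∀ (W : WeierstrassCurve ℚ) [W.IsElliptic] [W.IsGloballyMinimal] (p : ℕ) [Fact p.Prime], p ≠ 2 →
      IsOrdinaryAt W p → ∀ {N : ℕ} [NeZero N] (f : CuspForm (CongruenceSubgroup.Gamma0 N) 2),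
      IsNewformOf W f → (W.analyticRank : ℕ∞) ≤ (padicLFunction f (unitRoot W p : ℚ_[p])).order :=
  Iff.rfl

/-! ## (2) S → C modulo Kato: under BSD-rank the crux is the registered Kato item verbatim -/

/-- Under BSD-rank, C1 ↔ the registered support item stmt-0491 (`KatoTransfer.KatoRankBound`,
Kato 2004 Thm 18.4): the two decls differ only in `analyticRank` vs `mordellWeilRank`. -/
theorem iff_katoRankBound_of_bsd (hS : _root_.BirchSwinnertonDyer) :
    AnalyticRankLePadicOrder ↔ KatoTransfer.KatoRankBound := by
  constructor
  · intro h W hE _ p _ hp hord N _ f hf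
    have hb : W.analyticRank = W.mordellWeilRank := hS W hE
    have h1 := h W p hp hord f hf
    rwa [hb] at h1
  · intro h W hE _ p _ hp hord N _ f hf
    have hb : W.analyticRank = W.mordellWeilRank := hS W hE
    have h1 := h W p hp hord f hf
    rwa [← hb] at h1

/-- The same with the PAdicOrderV2 spelling of stmt-0491. -/
theorem iff_katoSideR2_of_bsd (hS : _root_.BirchSwinnertonDyer) :
    AnalyticRankLePadicOrder ↔ PAdicOrderV2.PAdicOrderKatoSideR2 := by
  constructor
  · intro h W hE _ p _ hp hord N _ f hf
    have hb : W.analyticRank = W.mordellWeilRank := hS W hE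
    have h1 := h W p hp hord f hf
    rwa [hb] at h1
  · intro h W hE _ p _ hp hord N _ f hf
    have hb : W.analyticRank = W.mordellWeilRank := hS W hE
    have h1 := h W p hp hord f hf
    rwa [← hb] at h1

/-- S → C modulo the registered Kato item: `BSD → KatoRankBound → C1`. -/
theorem of_bsd_of_katoRankBound (hS : _root_.BirchSwinnertonDyer) (hK : KatoTransfer.KatoRankBound) :
    AnalyticRankLePadicOrder :=
  (iff_katoRankBound_of_bsd hS).mpr hK

/-- S → C modulo the Literature fact (Kato, Astérisque 295, Thm 18.4, odd good ordinary `p`). -/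
theorem of_bsd_of_katoFact
    (hK : ∀ (W : WeierstrassCurve ℚ) [W.IsElliptic] [W.IsGloballyMinimal] (p : ℕ) [Fact p.Prime]
      {N : ℕ} [NeZero N] {f : CuspForm (CongruenceSubgroup.Gamma0 N) 2},
      kato_mordellWeilRank_le_order_padicLFunction W p (f := f))
    (hS : _root_.BirchSwinnertonDyer) : AnalyticRankLePadicOrder := by
  intro W hE _ p _ hp hord N _ f hf
  have hb : W.analyticRank = W.mordellWeilRank := hS W hE
  rw [hb]
  exact hK W p hp hord hf

/-- (2c) C1 is the `≥ r_an` half of the equality crux stmt-0489 (MTT order comparison at every good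
ordinary prime, `p = 2` included). -/
theorem of_comparisonR2 (h : PAdicOrderV2.PAdicOrderComparisonR2) : AnalyticRankLePadicOrder :=
  fun W _ _ p _ _ hord _ _ f hf => le_of_eq (h W p hord f hf).symm

/-! ## (3) non-vacuity: the hypotheses are inhabited (E₁ = 32a2 at p = 5), and C is TRUE there -/

-- (3a) `p ≠ 2 ∧ IsOrdinaryAt W p` for an elliptic globally minimal `W`, in Lean
example : ∃ (W : WeierstrassCurve ℚ) (_ : W.IsElliptic) (_ : W.IsGloballyMinimal) (p : ℕ)
    (_ : Fact p.Prime), p ≠ 2 ∧ IsOrdinaryAt W p := by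
  haveI : Fact (Nat.Prime 5) := ⟨by norm_num⟩
  haveI : (congruentNumberCurve 1).IsElliptic := isElliptic_congruentNumberCurve one_ne_zero
  haveI : (congruentNumberCurve 1).IsGloballyMinimal :=
    isGloballyMinimal_congruentNumberCurve squarefree_one
  exact ⟨congruentNumberCurve 1, inferInstance, inferInstance, 5, inferInstance, by norm_num,
    ConsistencyNegative.isOrdinaryAt_congruentNumberCurve_one_five⟩

-- (3b) ... together with a newform, modulo the route's own support item `Modularity` (BCDT)
example (hmod : Modularity) : ∃ (W : WeierstrassCurve ℚ) (_ : W.IsElliptic) (_ : W.IsGloballyMinimal)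
    (p : ℕ) (_ : Fact p.Prime) (N : ℕ) (_ : NeZero N) (f : CuspForm (CongruenceSubgroup.Gamma0 N) 2),
    p ≠ 2 ∧ IsOrdinaryAt W p ∧ IsNewformOf W f := by
  haveI : Fact (Nat.Prime 5) := ⟨by norm_num⟩
  haveI : (congruentNumberCurve 1).IsElliptic := isElliptic_congruentNumberCurve one_ne_zero
  haveI : (congruentNumberCurve 1).IsGloballyMinimal :=
    isGloballyMinimal_congruentNumberCurve squarefree_one
  haveI : NeZero ((congruentNumberCurve 1).conductorNorm ℤ) :=
    ⟨((congruentNumberCurve 1).conductorNorm_pos_holds).ne'⟩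
  obtain ⟨f, hf⟩ := hmod (congruentNumberCurve 1)
  exact ⟨congruentNumberCurve 1, inferInstance, inferInstance, 5, inferInstance, _, inferInstance, f,
    by norm_num, ConsistencyNegative.isOrdinaryAt_congruentNumberCurve_one_five, hf⟩

-- (3c) the E₁-instance of C is TRUE at every prime and every form (r_an(E₁) = 0): no kill from E₁
example (p : ℕ) [Fact p.Prime] {N : ℕ} (f : CuspForm (CongruenceSubgroup.Gamma0 N) 2)
    [(congruentNumberCurve 1).IsGloballyMinimal] :
    ((congruentNumberCurve 1).analyticRank : ℕ∞) ≤
      (padicLFunction f (unitRoot (congruentNumberCurve 1) p : ℚ_[p])).order := by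
  rw [PinchPrime.Negative.analyticRank_congruentNumberCurve_one]
  simp

/-! ## (4) junk levers of the definitions all point TRUE-wards for C -/

-- (4a) off the ordinary locus (`p ∣ a_p`): `unitRoot = 0`, `L_p(f, 0, T) = 0`, order `⊤`
example (W : WeierstrassCurve ℚ) [W.IsGloballyMinimal] (p : ℕ) [Fact p.Prime]
    (hdvd : (p : ℤ) ∣ W.frobeniusTrace p) {N : ℕ} (f : CuspForm (CongruenceSubgroup.Gamma0 N) 2) :
    (W.analyticRank : ℕ∞) ≤ (padicLFunction f (unitRoot W p : ℚ_[p])).order := by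
  rw [pAdicOrderComparisonR2_unitRoot_eq_zero_of_dvd_frobeniusTrace W p hdvd, PadicInt.coe_zero,
    pAdicOrderComparisonR2_padicLFunction_zero_root, PowerSeries.order_zero]
  exact le_top

-- (4b) the zero form (excluded by `IsNewformOf`, `pAdicOrderComparisonR2_not_isNewformOf_zero`) would
--      satisfy C anyway: `L_p(0, α, T) = 0`
example (W : WeierstrassCurve ℚ) [W.IsGloballyMinimal] (p : ℕ) [Fact p.Prime] {N : ℕ} :
    (W.analyticRank : ℕ∞) ≤
      (padicLFunction (0 : CuspForm (CongruenceSubgroup.Gamma0 N) 2) (unitRoot W p : ℚ_[p])).order := by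
  rw [pAdicOrderComparisonR2_padicLFunction_zero_form, PowerSeries.order_zero]
  exact le_top

-- (4c) junk `analyticRank = 0` (no entire continuation / identically zero near 1) makes C true
example (W : WeierstrassCurve ℚ) [W.IsGloballyMinimal] (p : ℕ) [Fact p.Prime] {N : ℕ}
    (f : CuspForm (CongruenceSubgroup.Gamma0 N) 2) (h0 : W.analyticRank = 0) :
    (W.analyticRank : ℕ∞) ≤ (padicLFunction f (unitRoot W p : ℚ_[p])).order := by
  rw [h0]; simp

/-! ## (5) what C buys in `closes`: the UP chain at the prime of C2 -/

/-- C1 at the C2-prime: `2 ≤ r_an → r_an ≤ r_MW` on global minimal models (Modularity supplies `f`). -/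
theorem analyticRank_le_mordellWeilRank_of_C1_C2 (h1 : AnalyticRankLePadicOrder)
    (h2 : PadicOrderLeRankAtOnePrime) (hmod : Modularity) (W : WeierstrassCurve ℚ) [W.IsElliptic]
    [W.IsGloballyMinimal] (h : 2 ≤ W.analyticRank) : W.analyticRank ≤ W.mordellWeilRank := by
  haveI : NeZero (W.conductorNorm ℤ) := ⟨(W.conductorNorm_pos_holds).ne'⟩
  obtain ⟨p, hp, hp2, hord, hle⟩ := h2 W h
  obtain ⟨f, hf⟩ := hmod W
  have hup : (W.analyticRank : ℕ∞) ≤ (W.mordellWeilRank : ℕ∞) := (h1 W p hp2 hord f hf).trans (hle f hf)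
  exact_mod_cast hup

/-! ## (6) hypothesis mutation -/

/-- `p ≠ 2` is not needed for TRUTH under BSD: Kato's bound as printed holds at every good ordinary
prime (`kato_selmerCorank_le_order_padicLFunction_allPrimes`, `p = 2` included) and
`r_MW ≤ corank Sel_{p^∞}` is the PROVED Kummer identity. -/
theorem anyPrime_of_bsd_of_katoAll
    (hK : ∀ (W : WeierstrassCurve ℚ) [W.IsElliptic] [W.IsGloballyMinimal] (p : ℕ) [Fact p.Prime]
      {N : ℕ} [NeZero N] {f : CuspForm (CongruenceSubgroup.Gamma0 N) 2},
      kato_selmerCorank_le_order_padicLFunction_allPrimes W p (f := f))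
    (hS : _root_.BirchSwinnertonDyer) :
    ∀ (W : WeierstrassCurve ℚ) [W.IsElliptic] [W.IsGloballyMinimal] (p : ℕ) [Fact p.Prime],
      IsOrdinaryAt W p → ∀ {N : ℕ} [NeZero N] (f : CuspForm (CongruenceSubgroup.Gamma0 N) 2),
      IsNewformOf W f → (W.analyticRank : ℕ∞) ≤ (padicLFunction f (unitRoot W p : ℚ_[p])).order := by
  intro W hE _ p _ hord N _ f hf
  have hb : W.analyticRank = W.mordellWeilRank := hS W hE
  have hid := WeierstrassCurve.selmerCorank_eq_mordellWeilRank_add_holds W p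
  have hle : W.analyticRank ≤ W.selmerCorank p := by omega
  calc (W.analyticRank : ℕ∞) ≤ (W.selmerCorank p : ℕ∞) := by exact_mod_cast hle
    _ ≤ _ := hK W p hord hf

/-- The planner's rank ≥ 4 plan in one line: X2 (`KatoTransfer.AnalyticRankLeSelmerCorank`, stmt-18412:
`r_an ≤ corank Sel_{p^∞}` at good ordinary `p ≥ 5`) + Kato's Selmer-corank form give C1 ON `5 ≤ p`
(C1 as typed also covers `p = 3`, which X2 as typed does not). -/
theorem five_le_of_X2_of_katoSelmer (hX2 : KatoTransfer.AnalyticRankLeSelmerCorank)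
    (hK : ∀ (W : WeierstrassCurve ℚ) [W.IsElliptic] [W.IsGloballyMinimal] (p : ℕ) [Fact p.Prime]
      {N : ℕ} [NeZero N] {f : CuspForm (CongruenceSubgroup.Gamma0 N) 2},
      kato_selmerCorank_le_order_padicLFunction W p (f := f)) :
    ∀ (W : WeierstrassCurve ℚ) [W.IsElliptic] [W.IsGloballyMinimal] (p : ℕ) [Fact p.Prime], 5 ≤ p →
      IsOrdinaryAt W p → ∀ {N : ℕ} [NeZero N] (f : CuspForm (CongruenceSubgroup.Gamma0 N) 2),
      IsNewformOf W f → (W.analyticRank : ℕ∞) ≤ (padicLFunction f (unitRoot W p : ℚ_[p])).order := by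
  intro W _ _ p _ h5 hord N _ f hf
  have hp2 : p ≠ 2 := by omega
  have hle : W.analyticRank ≤ W.selmerCorank p := hX2 W p h5 hord.1 hord.2
  calc (W.analyticRank : ℕ∞) ≤ (W.selmerCorank p : ℕ∞) := by exact_mod_cast hle
    _ ≤ _ := hK W p hp2 hord hf

/-- `[W.IsElliptic]` is redundant in C (implied by good reduction inside `IsOrdinaryAt`); recorded by the
sibling disproof of stmt-0489. Here only: C with the conclusion for ALL primes and no ordinarity is
still implied by BSD off the ordinary locus for free (4a), so `IsOrdinaryAt` is load-bearing for
MEANING (the tree's `L_p` is the MTT function only at good ordinary `p`), not for truth. -/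
example (hS : _root_.BirchSwinnertonDyer)
    (hK : ∀ (W : WeierstrassCurve ℚ) [W.IsElliptic] [W.IsGloballyMinimal] (p : ℕ) [Fact p.Prime]
      {N : ℕ} [NeZero N] {f : CuspForm (CongruenceSubgroup.Gamma0 N) 2},
      kato_selmerCorank_le_order_padicLFunction_allPrimes W p (f := f))
    (W : WeierstrassCurve ℚ) [W.IsElliptic] [W.IsGloballyMinimal] (p : ℕ) [Fact p.Prime]
    (hgood_or : IsOrdinaryAt W p ∨ (p : ℤ) ∣ W.frobeniusTrace p)
    {N : ℕ} [NeZero N] (f : CuspForm (CongruenceSubgroup.Gamma0 N) 2) (hf : IsNewformOf W f) :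
    (W.analyticRank : ℕ∞) ≤ (padicLFunction f (unitRoot W p : ℚ_[p])).order := by
  rcases hgood_or with hord | hdvd
  · exact anyPrime_of_bsd_of_katoAll hK hS W p hord f hf
  · rw [pAdicOrderComparisonR2_unitRoot_eq_zero_of_dvd_frobeniusTrace W p hdvd, PadicInt.coe_zero,
      pAdicOrderComparisonR2_padicLFunction_zero_root, PowerSeries.order_zero]
    exact le_top

#print axioms iff_katoRankBound_of_bsd
#print axioms of_bsd_of_katoFact
#print axioms of_comparisonR2
#print axioms analyticRank_le_mordellWeilRank_of_C1_C2
#print axioms anyPrime_of_bsd_of_katoAll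
#print axioms five_le_of_X2_of_katoSelmer

end Summit.BirchSwinnertonDyer.BirchSwinnertonDyer.Cruxes.AnalyticRankLePadicOrder.CruxAttack
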